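import Summits.CriticalPhenomena.SAWScalingLimit.Theses.SAWReversalUpgrade
import HarnessLib

/-!
# Sketch (crux-ideate, ideator 2): the NAKED-ROOT reduction of `SAWReversalUpgrade.NoDeepReturn`

Idea card `naked-root-localisation` (stmt-CriticalPhenomena-18004).

Lever. Reverse the walk (exact: `LawReversal`, landed), cut the REVERSED walk `b_δ → a_δ` at its
FIRST ENTRANCE `y` into an entrance set `A` of vertices near `a` (exact domain-Markov); every deep
return of the original walk makes the remainder `y → a_δ` travel `ε`-far; the remainder's total
mass is bounded BELOW by the walks confined to `A` (they avoid the prefix for free, because the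
prefix has no vertex in `A`), and the far remainders are bounded ABOVE by the far two-point mass of
`D_δ`. Summing over prefixes (no sup over pasts is ever taken on the INSIDE):

  `P(deep return landing in A) ≤ sup_{y ∈ A} W^{far ε}_D(y → a_δ) / W^{A-confined}_D(y → a_δ)`.

With `A` = the Stolz (non-tangential) part of the root ball, the right side is the atom
`RootLocalisation` — a statement about the critical two-point function at ONE boundary point, with
no second marked point, no past and no chordal normalisation; the returns landing in the boundary
collar are the residual `CollarReturnAvoidance`.

Typed here (all elaborate; proofs are not the point of this file): the generic provable first lemma
`FirstEntranceFarBound`, the atom, the residual, and the glue statement concluding the crux BY NAME.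
-/

noncomputable section

namespace Summit.CriticalPhenomena.SAWScalingLimit.Cruxes.NoDeepReturn.Ideator2

open MeasureTheory Filter Topology Set Metric
open scoped NNReal ENNReal
open Literature.Probability.RandomPlanarGeometry
open Literature.Probability.RandomPlanarGeometry.SAW
open Literature.Probability.LatticeModels (Site meshPoint discreteDomainGraph)

/-- The crux, by name. -/
abbrev Crux : Prop := Summit.CriticalPhenomena.SAWScalingLimit.Theses.SAWReversalUpgrade.NoDeepReturn

/-! ## Generic first-entrance machinery (any entrance predicate `A`) -/

/-- Walks from `y` to `v` that visit a vertex at distance `≥ ε` from `c` (their weight is the FAR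
two-point mass `W^{far ε}(y → v)`). -/
def farSet (Ω : Set ℂ) (δ : ℝ) (y v : Site 2) (c : ℂ) (ε : ℝ) : Set (DomainSAW Ω δ y v) :=
  {γ | ∃ j ≤ γ.walk.length, ε ≤ dist (meshPoint δ (γ.walk.getVert j)) c}

/-- Walks from `y` to `v` all of whose vertices satisfy the entrance predicate `A` (their weight is
the `A`-CONFINED two-point mass `W^{A}(y → v)`). -/
def confSet (Ω : Set ℂ) (δ : ℝ) (y v : Site 2) (A : Site 2 → Prop) : Set (DomainSAW Ω δ y v) :=
  {γ | ∀ j ≤ γ.walk.length, A (γ.walk.getVert j)}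

/-- **First lemma of the line (provable, L): the FIRST-ENTRANCE FAR BOUND**, for an ARBITRARY
entrance predicate `A` containing the target `v`. If from every `A`-vertex `y` the far mass to `v`
is at most `η` times the `A`-confined mass, then under the critical law from `u` to `v` the event
"some vertex in `A`, a LATER vertex `ε`-far from `c`" has probability `≤ η`.
Proof: `Z(u→v) = Σ_π x_c^{|π|} Z_{Ω∖π°}(y_π → v)` over first-entrance prefixes `π` into `A`
(bijection); on the event the remainder is far, so `W(event) ≤ Σ_π x_c^{|π|} W^{far}(y_π)`; and
`Z_{Ω∖π°}(y → v) ≥ W^{A}(y)` since an `A`-confined walk never meets `π°` (no vertex of `π°` is in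
`A`); hence `W(event) ≤ η Σ_π x_c^{|π|} W^{A}(y_π) ≤ η Z`. No positivity of `W^{A}` is needed. -/
def FirstEntranceFarBound : Prop :=
  ∀ (Ω : Set ℂ), Bornology.IsBounded Ω → ∀ (δ : ℝ), 0 < δ →
    ∀ (u v : Site 2) (A : Site 2 → Prop) (c : ℂ) (ε η : ℝ), 0 ≤ η → A v →
    (∀ y : Site 2, A y →
      weight Ω δ y v (farSet Ω δ y v c ε) ≤ ENNReal.ofReal η * weight Ω δ y v (confSet Ω δ y v A)) →
    law Ω δ u v {γ | ∃ i j : ℕ, i < j ∧ j ≤ γ.walk.length ∧ A (γ.walk.getVert i) ∧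
      ε ≤ dist (meshPoint δ (γ.walk.getVert j)) c} ≤ ENNReal.ofReal η

/-- Statement of the first lemma as the line's first theorem (to be proved there). -/
theorem firstEntranceFarBound : FirstEntranceFarBound := by
  sorry

/-! ## The entrance set: the Stolz (non-tangential) part of the root ball -/

/-- `v` is a STOLZ vertex of the root ball: within `ρ` of `a = D.pt 0` and with clearance from `∂D`
at least `κ` times its distance to the root vertex `a_δ` (relative-width-`κ` non-tangential region;
`a_δ` itself qualifies). -/
def InStolz (D : DobrushinDomain) (δ : ℝ) (a₀ : Site 2) (κ ρ : ℝ) (v : Site 2) : Prop :=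
  dist (meshPoint δ v) (D.pt 0) ≤ ρ ∧
    κ * dist (meshPoint δ v) (meshPoint δ a₀) ≤ Metric.infDist (meshPoint δ v) D.carrierᶜ

/-- The entrance set `A`: Stolz vertices joined to the root vertex `a_δ` THROUGH Stolz vertices
(so that `A`-confined walks from them to `a_δ` exist). For an inner-regular germ (e.g. `∂D` a
Lipschitz graph near `a`) and small `κ` this is the whole non-tangential cone of the root ball. -/
def StolzReach (D : DobrushinDomain) (δ : ℝ) (a₀ : Site 2) (κ ρ : ℝ) (y : Site 2) : Prop :=
  ∃ p : (discreteDomainGraph D.carrier δ).Walk y a₀, ∀ w ∈ p.support, InStolz D δ a₀ κ ρ w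

/-- **THE ATOM (open): ROOT TWO-POINT LOCALISATION.** For every Dobrushin domain and root
approximation `δ·a_δ → a`, every `κ ∈ (0,1)` and `ε, η > 0` there is `r₀ > 0` such that for every
`ρ ∈ (0, r₀]`, all small `δ` and every vertex `y` of the Stolz entrance set of the `ρ`-ball, the
`x_c`-mass of walks of `D_δ` from `y` to `a_δ` that reach distance `ε` from `a` is at most `η` times
the mass of those confined to the Stolz entrance set. One boundary point, one two-point function:
no `b`, no past, no chordal normalisation. Predicted ratio `≍ (ρ/ε)^{c}`, `c > 0` (fusion of the two
far strands into a boundary two-leg insertion at `a`); its lattice-local shadow (`y ∼ a_δ`,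
`ρ ≍ δ`) is the `Σ n pₙ μ^{-n} < ∞` finiteness of the census (D2). -/
def RootLocalisation : Prop :=
  ∀ (D : DobrushinDomain) (a : ℝ → Site 2),
    Tendsto (fun δ => meshPoint δ (a δ)) (𝓝[>] (0 : ℝ)) (𝓝 (D.pt 0)) →
    ∀ κ : ℝ, 0 < κ → κ < 1 → ∀ ε : ℝ, 0 < ε → ∀ η : ℝ, 0 < η → ∃ r₀ : ℝ, 0 < r₀ ∧
      ∀ ρ : ℝ, 0 < ρ → ρ ≤ r₀ → ∀ᶠ δ in 𝓝[>] (0 : ℝ),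
        ∀ y : Site 2, StolzReach D δ (a δ) κ ρ y →
          weight D.carrier δ y (a δ) (farSet D.carrier δ y (a δ) (D.pt 0) ε)
            ≤ ENNReal.ofReal η *
              weight D.carrier δ y (a δ) (confSet D.carrier δ y (a δ) (StolzReach D δ (a δ) κ ρ))

/-- **THE RESIDUAL (open; a sub-event of the crux): COLLAR RETURN AVOIDANCE.** Deep returns that
LAND OUTSIDE the Stolz entrance set — in the boundary collar of relative width `κ` at `a`, or in a
pocket not Stolz-connected to `a_δ` — have small probability once `κ` is small: for all `ε, η`
there are `κ ∈ (0,1)` and `r₀` with, for every `ρ ≤ r₀` and all small `δ`, law `≤ η` of "`ε`-far at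
some vertex, later `ρ`-close to `a` at a non-entrance vertex". Boundary-layer (one-arm-type)
content, not three-arm content; vacuous direction of difficulty: `κ → 0`, not `ρ → 0`. -/
def CollarReturnAvoidance : Prop :=
  ∀ (D : DobrushinDomain) (a b : ℝ → Site 2), IsEndpointApprox D a b →
    ∀ ε : ℝ, 0 < ε → ∀ η : ℝ, 0 < η → ∃ κ : ℝ, 0 < κ ∧ κ < 1 ∧ ∃ r₀ : ℝ, 0 < r₀ ∧
      ∀ ρ : ℝ, 0 < ρ → ρ ≤ r₀ → ∀ᶠ δ in 𝓝[>] (0 : ℝ),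
        law D.carrier δ (a δ) (b δ) {γ | ∃ i j : ℕ, i < j ∧ j ≤ γ.walk.length ∧
          ε ≤ dist (meshPoint δ (γ.walk.getVert i)) (D.pt 0) ∧
          dist (meshPoint δ (γ.walk.getVert j)) (D.pt 0) ≤ ρ ∧
          ¬ StolzReach D δ (a δ) κ ρ (γ.walk.getVert j)} ≤ ENNReal.ofReal η

/-- **Glue (provable, M–L): the naked-root reduction concludes the crux BY NAME.** Given `ε, η`:
take `κ, r₁` from the residual (`ε/2, η/2`), `r₂` from the atom (`κ, ε/2, η/2`), `ρ := min r₁ r₂`,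
`r := ρ/2`; for `δ < ρ/2 ∧ δ < ε/2`: polyline event ⇒ vertex event (`ε − δ ≥ ε/2` far, `r + δ ≤ ρ`
close; census piece `PolylineToVertex`); split the close vertex by `StolzReach`; the Stolz part is,
after exact reversal (`lawReversal_proof`), the event of `FirstEntranceFarBound` for the walk
`b_δ → a_δ` with `A := StolzReach … κ ρ`, `v := a_δ` (`A v` by the nil walk, `a_δ` being `ρ`-close
eventually — `IsEndpointApprox.tendsto_fst`, the load-bearing endpoint limit of the landed Negative
lemma); the collar part is the residual. -/
theorem noDeepReturn_of_rootLocalisation (h₀ : FirstEntranceFarBound) (h₁ : RootLocalisation)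
    (h₂ : CollarReturnAvoidance) : Crux := by
  sorry

end Summit.CriticalPhenomena.SAWScalingLimit.Cruxes.NoDeepReturn.Ideator2

end
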